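import Summits.ValiantsHypothesis.ValiantsHypothesis.Theorems.LacunarySymmetroidMatrixDescartesCensusV20SoundCoverX

/-!
# `MatrixDescartes` census — cover of a range of shells by 2-Sidon keys and mirrors with an exception list, for the row `ζ ≤ 18`

HONEST FRAMING.  Object-search cell `pub-symmetroid`; door-A item `DoorA26 = PosRootLawAt 2 6 19`
(stmt-ValiantsHypothesis-19979; OPEN, typed, never asserted) and its sharper support rows `PosRootLawOn 2 6 18 d`.  ONE soundness theorem, the
`ζ ≤ 18` sibling of `V20.box_of_planX` (`…CensusV20SoundCoverX`, which concludes the `ζ ≤ 19` row and treats non-Sidon supports by Descartes): if the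
kernel cover check `V20.coverSlicesX exc keys P` passes on a slice plan exhausting the tops `lo ≤ d₅ ≤ N` (`V20.planCoversR`), and every KEY carries the
row `ζ(2,6; key) ≤ 18`, then every sorted 2-SIDON support `0 = d₀ < ⋯ < d₅` with `lo ≤ d₅ ≤ N` outside `exc` carries `ζ(2,6; d) ≤ 18` — a key directly, a
mirror of a key by `Census.posRootLawOn_iff_mirror_rev`; the non-Sidon escape of the cover cell is excluded by hypothesis.  Used by the 2-Sidon `V = 19`
shell assemblies `…CensusV19SShells*`.  Nothing here bears on `ζ_sym(2,6)` over all supports, on `DoorA26` itself, on `MatrixDescartes`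
(stmt-ValiantsHypothesis-18050) or on `VP ≠ VNP`.

[folklore] Bookkeeping; elementary.
-/

-- the D-0017 layout repeats a namespace component (single-conjunct summit); the `dupNamespace` linter flags it; name mandated.
set_option linter.dupNamespace false

namespace Summit.ValiantsHypothesis.ValiantsHypothesis.Theorems.LacunarySymmetroidMatrixDescartes.Census.V19S

open V20 (incLists sidon mirror keysTop coverCell coverCellX coverRowX coverSliceX coverSlicesX planCoversR mem_incLists_three mirror_six)

/-- **Soundness of the cover by 2-Sidon keys and mirrors with an exception list, row `ζ ≤ 18`.** [folklore] -/
theorem box_of_planS (lo N : ℕ) (P : List (ℕ × ℕ × ℕ)) (exc keys : List (List ℕ)) (hplan : planCoversR lo N P = true)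
    (hslices : coverSlicesX exc keys P = true) (hkeys : ∀ dl ∈ keys, PosRootLawOn 2 6 18 (fun i => dl.getD i 0))
    (d : Fin 6 → ℕ) (hd : StrictMono d) (h0 : d 0 = 0) (hlo : lo ≤ d 5) (hN : d 5 ≤ N)
    (hsid : sidon [d 0, d 1, d 2, d 3, d 4, d 5] = true) (hexc : [d 0, d 1, d 2, d 3, d 4, d 5] ∉ exc) : PosRootLawOn 2 6 18 d := by
  have hdf : (fun i : Fin 6 => [d 0, d 1, d 2, d 3, d 4, d 5].getD i 0) = d := by
    funext i; fin_cases i <;> rfl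
  have h45 := hd (show (4 : Fin 6) < 5 by decide)
  unfold planCoversR at hplan
  rw [List.all_eq_true] at hplan
  have hf := hplan (d 5) (List.mem_range'_1.2 ⟨hlo, by omega⟩)
  rw [List.all_eq_true] at hf
  have he := hf (d 4) (List.mem_range.2 h45)
  have h4 : Nat.ble 4 (d 4) = true := by
    have h01 := hd (show (0 : Fin 6) < 1 by decide)
    have h12 := hd (show (1 : Fin 6) < 2 by decide)
    have h23 := hd (show (2 : Fin 6) < 3 by decide)
    have h34 := hd (show (3 : Fin 6) < 4 by decide)
    simp only [Nat.ble_eq]; omega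
  rw [h4, Bool.not_true, Bool.false_or, List.any_eq_true] at he
  obtain ⟨s, hs, hsb⟩ := he
  simp only [Bool.and_eq_true, beq_iff_eq, Nat.ble_eq] at hsb
  obtain ⟨⟨hs1, hs2⟩, hs3⟩ := hsb
  unfold coverSlicesX at hslices
  rw [List.all_eq_true] at hslices
  have hsl := hslices s hs
  unfold coverSliceX at hsl
  rw [List.all_eq_true] at hsl
  have hrw := hsl (d 4) (List.mem_range'_1.2 ⟨hs2, by omega⟩)
  unfold coverRowX at hrw
  rw [List.all_eq_true] at hrw
  have h := hrw _ (mem_incLists_three d hd h0)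
  unfold coverCellX coverCell at h
  rw [hs1] at h
  have hl : (0 :: ([d 1, d 2, d 3] ++ [d 4, d 5])) = [d 0, d 1, d 2, d 3, d 4, d 5] := by rw [h0]; rfl
  rw [hl] at h
  simp only [Bool.or_eq_true, Bool.not_eq_true'] at h
  rcases h with hx | ((hns | hk) | hm)
  · exact absurd (List.elem_iff.1 hx) hexc
  · rw [hns] at hsid; exact absurd hsid (by decide)
  · rw [← hdf]
    exact hkeys _ (List.mem_of_mem_filter (List.mem_of_mem_filter (List.elem_iff.1 hk)))
  · have hrow := hkeys _ (List.mem_of_mem_filter (List.mem_of_mem_filter (List.elem_iff.1 hm)))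
    rw [mirror_six] at hrow
    exact (posRootLawOn_iff_mirror_rev d (d 5) (fun l => hd.monotone (Fin.le_last l))).2 hrow

end Summit.ValiantsHypothesis.ValiantsHypothesis.Theorems.LacunarySymmetroidMatrixDescartes.Census.V19S
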